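import Summits.BirchSwinnertonDyer.BirchSwinnertonDyer.Theorems.ByReductionTypeAtTwoAdditiveKatoTransportQuadraticLayerModel
import Summits.BirchSwinnertonDyer.BirchSwinnertonDyer.Theorems.TwoAdicConverseOrdLambdaHalfAtTwoShapiroLatticeSupply
import HarnessLib

/-!
# Route ByReductionTypeAtTwo, crux `AdditivePotMultOverKAtTwo` (stmt-BirchSwinnertonDyer-22618) — the model identification
# `Sel_{2^∞}((E′)_F/F_∞) ≃+ Sel_{2^∞}(E′/ℚ_∞(θ))` for EVERY imaginary quadratic field `F = ℚ(θ)`, `θ² = d < 0`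
# (both split-twist blocks: `d = −1` AND `d = −2`)

Cell `bsd-2adic`, seat `bsd-2adic-t42` GEN 24, part C. `…AdditiveKatoTransportQuadraticLayerModel` (p703782) constructed the model
identification for `θ² = −1` only (the (−1)-split-twist block of C4″ 22618). The (−2)-block needs `F = ℚ(√−2)`; the construction
is uniform in a negative rational `d` (any imaginary quadratic `F` misses `√2`, so the cyclotomic `ℤ₂`-extension restricts ONTO
`Γ_F`), and this file redoes it for general `d < 0`. HONEST FRAMING (D-0036 / D-0054): theorems only; types-the-object-of; closes
none; nothing booked; BSD is not proved by any of this. PARTITION: X5@2 additive, C4″ 22618, ALL FOUR (−1)/(−2) × irreducible/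
reducible split-twist sub-blocks × `p = 2`.

* §1 the imaginary quadratic field `F ∋ θ_F`, `θ_F² = d < 0`: `θ_F ∉ ℚ`, `F` imaginary quadratic (conv-1's `sq_ne_two`,
  `surjective_comp_absGaloisRestrict_two` reused by import), **`mem_galRange_iff_smul_eq_of_sq_eq`** (`galRange F = Stab θ` for
  ANY `θ ∈ ℚ̄` with `θ² = d`: `θ = ±√d`, conv-1/additive-branch `mem_galRange_iff_smul_geomSqrt_eq`),
  **`galImage_kerSubgroup_restrict_eq_kerStab_of_sq_eq`**.
* §2 **`exists_selmerInfty_model_of_sq_eq`**: for `κ` cyclotomic, `γ` a topological generator fixing `θ` (`θ² = d < 0`) and a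
  quadratic `F ∋ θ_F` with `θ_F² = d`: ∃ `κ_F = κ ∘ res` (cyclotomic), `γ_F` (top generator, `res γ_F = γ`),
  `ΘS : Sel_{2^∞}((W′)_F/F_∞) ≃+ W′.selmerGroupOver 2 (kerStab κ θ)` with `ΘS ∘ conj_{γ_F} = conj_γ ∘ ΘS` (GEN 24's
  `SelmerBaseChange.selmerModelIso` + `exists_selmerGroupOver_addEquiv_of_eq`).

References: [GreenbergLNM1716] §2, §4 p. 107; [SerreGaloisCohomology1997] I.§2.5, II.§1.1; [Washington1997] §13.1;
[Marcus1977] Ch. 2 Thm. 1; memo `run/shared/lean/pub/bsd-2adic/t42/DESIGN-T42-ADDENDUM-28.md`.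
-/

set_option autoImplicit false
-- the summit's namespace `Summit.BirchSwinnertonDyer.BirchSwinnertonDyer` (Sub = Summit) trips `dupNamespace`
set_option linter.dupNamespace false

noncomputable section

open scoped Classical NumberField

open Field WeierstrassCurve IsDedekindDomain
  Literature.NumberTheory.EllipticCurves Literature.NumberTheory.EllipticCurves.QuadraticLayer
  Literature.NumberTheory.EllipticCurves.BaseChangeModel Literature.NumberTheory.GaloisRepresentations

namespace Summit.BirchSwinnertonDyer.BirchSwinnertonDyer.Theorems.AddKatoTwoQuadLayerTwist

/-! ## §1 The imaginary quadratic field `F ∋ θ_F`, `θ_F² = d < 0` -/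

section Field

variable (F : Type) [Field F] [NumberField F] {θF : F} {d : ℚ}

/-- `θ_F ∉ ℚ` (a negative rational is not a rational square). [folklore] -/
theorem not_mem_range_algebraMap_of_sq_eq (hd : d < 0) (hθF : θF ^ 2 = algebraMap ℚ F d) :
    θF ∉ Set.range (algebraMap ℚ F) := by
  rintro ⟨q, hq⟩
  have h : algebraMap ℚ F (q ^ 2) = algebraMap ℚ F d := by rw [map_pow, hq, hθF]
  have hq2 : q ^ 2 = d := (algebraMap ℚ F).injective h
  nlinarith [sq_nonneg q]

/-- `F` is imaginary quadratic (`F = ℚ(√d)`, `d < 0`). [cite: Marcus1977, Ch. 2 Thm. 1] -/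
theorem isImaginaryQuadratic_of_sq_eq (hd : d < 0) (hθF : θF ^ 2 = algebraMap ℚ F d) (hF2 : Module.finrank ℚ F = 2) :
    IsImaginaryQuadratic F :=
  IsImaginaryQuadratic.of_sq_eq hF2 hθF hd

/-- **`Gal(ℚ̄/F) = Stab(θ)` for every `θ ∈ ℚ̄` with `θ² = d`**: `θ = ±√d` (`geomSqrt_sq`) and `σ ∈ galRange F` iff `σ` fixes `√d`
(additive branch's `mem_galRange_iff_smul_geomSqrt_eq`). [cite: Marcus1977, Ch. 2 Thm. 1] [cite: SerreGaloisCohomology1997, II.§1.1] -/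
theorem mem_galRange_iff_smul_eq_of_sq_eq (hd : d < 0) (hθF : θF ^ 2 = algebraMap ℚ F d) (hF2 : Module.finrank ℚ F = 2)
    {θ : AlgebraicClosure ℚ} (hθ : θ ^ 2 = algebraMap ℚ (AlgebraicClosure ℚ) d)
    (σ : absoluteGaloisGroup ℚ) : σ ∈ galRange (K := ℚ) F ↔ σ • θ = θ := by
  rw [AdditiveBranchIMCGreenbergVatsalResidualBranchTransport.mem_galRange_iff_smul_geomSqrt_eq F hF2
    (not_mem_range_algebraMap_of_sq_eq F hd hθF) hθF σ]
  have hsq : θ ^ 2 = geomSqrt d ^ 2 := hθ.trans (geomSqrt_sq d).symm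
  rcases sq_eq_sq_iff_eq_or_eq_neg.mp hsq with h | h
  · rw [h]
  · rw [h, smul_neg, neg_inj]

variable (κ : ZpExtension ℚ 2)

/-- **`κ ∘ res : Γ_F → ℤ₂` is onto** for the cyclotomic `ℤ₂`-extension `κ` of `ℚ` (`F` imaginary quadratic: `√2 ∉ F`; conv-1's
`surjective_comp_absGaloisRestrict_two`). [cite: Washington1997, §13.1] -/
theorem surjective_comp_absGaloisRestrict_of_sq_eq (hd : d < 0) (hθF : θF ^ 2 = algebraMap ℚ F d)
    (hF2 : Module.finrank ℚ F = 2) (hκ : κ.IsCyclotomic) :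
    Function.Surjective (κ.toContinuousMonoidHom.comp (absGaloisRestrict ℚ F)) :=
  TwoAdicShapiroLattice.surjective_comp_absGaloisRestrict_two F (isImaginaryQuadratic_of_sq_eq F hd hθF hF2) κ hκ

/-- **`galImage F (ker κ_F) = kerStab κ θ`** for `κ_F = κ ∘ res` and `θ² = d`: `res(ker κ_F) = ker κ ⊓ galRange F = ker κ ⊓ Stab(θ)`.
[cite: Washington1997, §13.1] [cite: GreenbergLNM1716, §4 p. 107] -/
theorem galImage_kerSubgroup_restrict_eq_kerStab_of_sq_eq (hd : d < 0) (hθF : θF ^ 2 = algebraMap ℚ F d)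
    (hF2 : Module.finrank ℚ F = 2) (h : Function.Surjective (κ.toContinuousMonoidHom.comp (absGaloisRestrict ℚ F)))
    {θ : AlgebraicClosure ℚ} (hθ : θ ^ 2 = algebraMap ℚ (AlgebraicClosure ℚ) d) :
    galImage ℚ F (κ.restrict F h).kerSubgroup = kerStab κ θ := by
  ext g
  rw [mem_galImage_iff, mem_kerStab_iff]
  constructor
  · rintro ⟨σ, hσ, rfl⟩
    rw [ZpExtension.kerSubgroup_restrict, Subgroup.mem_comap] at hσ
    refine ⟨?_, (mem_galRange_iff_smul_eq_of_sq_eq F hd hθF hF2 hθ _).mp ⟨σ, rfl⟩⟩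
    rw [resGal_eq_absGaloisRestrict]
    exact hσ
  · rintro ⟨hker, hfix⟩
    obtain ⟨σ, rfl⟩ := (mem_galRange_iff_smul_eq_of_sq_eq F hd hθF hF2 hθ g).mpr hfix
    refine ⟨σ, ?_, rfl⟩
    rw [ZpExtension.kerSubgroup_restrict, Subgroup.mem_comap]
    rw [resGal_eq_absGaloisRestrict] at hker
    exact hker

end Field

/-! ## §2 The model identification for `θ² = d < 0` -/

section Model

variable (κ : ZpExtension ℚ 2) (hκ : κ.IsCyclotomic) (W' : WeierstrassCurve ℚ) {d : ℚ}
  {θ : AlgebraicClosure ℚ} (hθ : θ ^ 2 = algebraMap ℚ (AlgebraicClosure ℚ) d)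
  {γ : absoluteGaloisGroup ℚ} (hγ : κ.IsTopGenerator γ) (hγθ : γ • θ = θ)

include hκ hθ hγ hγθ in
/-- **THE MODEL IDENTIFICATION for every imaginary quadratic `F = ℚ(θ_F)`, `θ_F² = d < 0`**: for the cyclotomic `ℤ₂`-extension `κ`
of `ℚ` and a topological generator `γ` fixing `θ` (`θ² = d`), there are a CYCLOTOMIC `κ_F = κ ∘ res`, a topological generator
`γ_F` with `res γ_F = γ`, and `ΘS : Sel_{2^∞}((W′)_F/F_∞) ≃+ W′.selmerGroupOver 2 (kerStab κ θ)` with `ΘS ∘ conj_{γ_F} = conj_γ ∘ ΘS`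
(`SelmerBaseChange.selmerModelIso` composed with the equal-subgroup identification along `galImage F (ker κ_F) = kerStab κ θ`).
The case `d = −1` is `AddKatoTwoQuadLayerModel.exists_selmerInfty_model`.
[cite: GreenbergLNM1716, §2 and §4 p. 107] [cite: SerreGaloisCohomology1997, I.§2.5, II.§1.1] [cite: Washington1997, §13.1] -/
theorem exists_selmerInfty_model_of_sq_eq [(kerStab κ θ).Normal] (hd : d < 0)
    (F : Type) [Field F] [NumberField F] {θF : F} (hθF : θF ^ 2 = algebraMap ℚ F d) (hF2 : Module.finrank ℚ F = 2) :
    ∃ (κF : ZpExtension F 2) (γF : absoluteGaloisGroup F), κF.IsCyclotomic ∧ κF.IsTopGenerator γF ∧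
      (∀ σ, κF σ = κ (absGaloisRestrict ℚ F σ)) ∧ resGal (K := ℚ) F γF = γ ∧
      ∃ ΘS : (W'.baseChange F).selmerInfty κF ≃+ W'.selmerGroupOver 2 (kerStab κ θ),
        ∀ s, ((ΘS ((W'.baseChange F).conjSelmerInfty κF γF s) : W'.selmerGroupOver 2 (kerStab κ θ)) :
            W'.subgroupH1 2 (kerStab κ θ)) = W'.conjH1 2 (kerStab κ θ) γ (ΘS s : W'.selmerGroupOver 2 (kerStab κ θ)) := by
  have hsurj := surjective_comp_absGaloisRestrict_of_sq_eq F κ hd hθF hF2 hκ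
  set κF := κ.restrict F hsurj with hκFdef
  obtain ⟨γF, hγF⟩ := (mem_galRange_iff_smul_eq_of_sq_eq F hd hθF hF2 hθ γ).mpr hγθ
  have hgal : galImage ℚ F κF.kerSubgroup = kerStab κ θ :=
    galImage_kerSubgroup_restrict_eq_kerStab_of_sq_eq F κ hd hθF hF2 hsurj hθ
  haveI : (galImage ℚ F κF.kerSubgroup).Normal := by rw [hgal]; infer_instance
  haveI : IsGalois ℚ F := by
    haveI : Algebra.IsQuadraticExtension ℚ F := ⟨hF2⟩
    infer_instance
  have hγres : absGaloisRestrict ℚ F γF = γ := by rw [← resGal_eq_absGaloisRestrict]; exact hγF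
  refine ⟨κF, γF, ZpExtension.isCyclotomic_restrict κ hκ F hsurj, ?_, fun σ ↦ rfl, hγF, ?_⟩
  · rw [ZpExtension.isTopGenerator_restrict_iff, hγres]
    exact hγ
  obtain ⟨Ψ, hΨ⟩ := AddKatoTwoQuadLayerModel.exists_selmerGroupOver_addEquiv_of_eq W' 2 hgal
  refine ⟨(SelmerBaseChange.selmerModelIso F κF.kerSubgroup W' 2).trans Ψ, fun s ↦ ?_⟩
  show ((Ψ (SelmerBaseChange.selmerModelIso F κF.kerSubgroup W' 2 ((W'.baseChange F).conjSelmerInfty κF γF s)) :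
      W'.selmerGroupOver 2 (kerStab κ θ)) : W'.subgroupH1 2 (kerStab κ θ)) =
    W'.conjH1 2 (kerStab κ θ) γ (Ψ (SelmerBaseChange.selmerModelIso F κF.kerSubgroup W' 2 s))
  rw [hΨ, hΨ]
  have h1 : ((SelmerBaseChange.selmerModelIso F κF.kerSubgroup W' 2 ((W'.baseChange F).conjSelmerInfty κF γF s) :
      W'.selmerGroupOver 2 (galImage ℚ F κF.kerSubgroup)) : W'.subgroupH1 2 (galImage ℚ F κF.kerSubgroup)) =
      W'.conjH1 2 (galImage ℚ F κF.kerSubgroup) γ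
        (SelmerBaseChange.selmerModelIso F κF.kerSubgroup W' 2 s : W'.selmerGroupOver 2 (galImage ℚ F κF.kerSubgroup)) := by
    rw [← hγF]
    exact SelmerBaseChange.coe_selmerModelIso_conjH1 F κF.kerSubgroup W' 2 γF s
  rw [h1]
  exact DFunLike.congr_fun (resOfLe_comp_conjH1_holds (M := W'.geomPrimaryTorsion 2) hgal.ge γ) _

end Model

end Summit.BirchSwinnertonDyer.BirchSwinnertonDyer.Theorems.AddKatoTwoQuadLayerTwist

end
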